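import Literature.AlgebraicGeometry.Limits.FiniteLocallyFreeIsoDescent
import Literature.AlgebraicGeometry.Limits.RankOnePullbackDense
import Literature.AlgebraicGeometry.Limits.FiniteLocallyFreeSubalgebraDescent
import Literature.AlgebraicGeometry.Limits.SubalgebraSpread
import Literature.AlgebraicGeometry.AbelianSchemes.PoincareUniversalLocality
import Literature.AlgebraicGeometry.AbelianSchemes.AbelianSchemeOverRigidity
import Literature.AlgebraicGeometry.AbelianVarieties.RigidifiedLineBundleFibrewisePicZeroOfDense
import Literature.AlgebraicGeometry.AbelianVarieties.StructureSheafSemiHomogeneous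
import HarnessLib

/-!
# A rigidified `Pic⁰` datum on `A_{Spec R}` descends, as such, to a finitely generated subalgebra

Topic: `Literature/AlgebraicGeometry/AbelianSchemes` (Noetherian approximation `Spec R = lim Spec K[t]`,
[EGAIV3] 8.5.2 / 8.8.2, [GortzWedhorn2020] Thm. 10.57 / 10.60, for the test data of [MumfordAV1970] §13).
For an abelian scheme `A` over `Spec K` (`K` a field), any `K`-algebra `R` and a rigidified line bundle `ℒ` on
`A_{Spec R}`: (§3) `ℒ` comes, AS A RIGIDIFIED LINE BUNDLE, from `A_{Spec K[t]}` for some finite `t ⊆ R`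
(`exists_stage_rigidifiedLineBundle`: the module descends — ★ `Limits/FiniteLocallyFreeSubalgebraDescent`,
Stacks 0B8W (1); it has rank one there — ★ `Limits.hasRank_of_hasRank_pullback_of_denseRange`; the rigidification
descends to a deeper stage — ★ `Limits.FiniteLocallyFreeIsoDescent.exists_stage_iso_of_pullback_iso`, Stacks 01ZR);
(§4) the fibrewise-`Pic⁰` condition along `1_A × w`, pointwise, as equivalences; (§5) the descended bundle is fibrewise
in `Pic⁰` whenever `ℒ` is and the `Pic⁰` locus over the stage is closed (★ `FibrewisePicZero.of_denseRange_of_isClosed`,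
B-p17, with the dominance ★ `SubalgApprox.denseRange_baseCone_π_app`). The cone legs / transition maps of ★
`SubalgApprox.prodCone` ARE the `1_A × w` of ★ `AbelianSchemes/PoincareUniversalLocality` (§1). Everything is proved;
theorems only (the four base-diagram facts of §2 are stated as theorems and used through `haveI`); no named facts.

## References
* [MumfordAV1970] D. Mumford, *Abelian Varieties* (1970), §13 (proof of the Thm. p. 125), §8 ((iv) ⇔ (i)).
* [EGAIV3] A. Grothendieck, J. Dieudonné, EGA IV₃ (1966), Thm. 8.5.2, Thm. 8.8.2.
* [StacksProject] The Stacks Project, Tags 0B8W (1), 01ZR (2)–(3), 00FL.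
* [GortzWedhorn2020] U. Görtz, T. Wedhorn, *Algebraic Geometry I*, 2nd ed. (2020), Thm. 10.57, Thm. 10.60, Section (4.7).
* [MilneAV2008] J. S. Milne, *Abelian Varieties* (2008), I §8 pp. 36–37.
-/

universe u

open CategoryTheory CategoryTheory.Limits AlgebraicGeometry MonoidalCategory

namespace Literature.AlgebraicGeometry.AbelianSchemes

open Literature.AlgebraicGeometry.Motives Literature.AlgebraicGeometry.AbelianVarieties
  Literature.AlgebraicGeometry.Modules Literature.AlgebraicGeometry.Limits
  Literature.AlgebraicGeometry.Limits.SubalgApprox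

set_option backward.isDefEq.respectTransparency false

namespace AbelianSchemeOver

section LimitDescent

variable {K : Type u} [Field K] (A B : AbelianSchemeOver (Spec (.of K))) (P : (A.prodLeft B).Modules)
  (R : Type u) [CommRing R] [Algebra K R]

/-! ### §1 Carrier junctions: `SubalgApprox.prodCone` legs ARE B-p02's `prodMap` -/

/-- The cone point of `prodCone K R s₁ A.X` is `A_{Spec R}` (definitional; the projective system
`X ×_{S₀} S_λ` of Görtz–Wedhorn I (10.13)). [cite: GortzWedhorn2020, (10.13) (pp. 261–262)] -/
theorem prodCone_pt_eq (s₁ : Finset R) :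
    (prodCone K R s₁ A.X).pt = (A.baseChange (specOver K R).hom).X.left := rfl

/-- The stages of `prodDiagram K R s₁ A.X` are the `A_{Spec K[t]}` (definitional; Görtz–Wedhorn I (10.13)).
[cite: GortzWedhorn2020, (10.13) (pp. 261–262)] -/
theorem prodDiagram_obj_eq (s₁ : Finset R) (t : (Idx R s₁)ᵒᵖ) :
    (prodDiagram K R s₁ A.X).obj t = (A.baseChange ((baseDiagram K R s₁).obj t).hom).X.left := rfl

/-- **The legs of `prodCone` are `1_A × (Spec R → Spec K[t])`.** [cite: GortzWedhorn2020, Section (4.7) (pp. 107–108)] -/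
theorem prodCone_π_app_eq_prodMap (s₁ : Finset R) (t : (Idx R s₁)ᵒᵖ) :
    (prodCone K R s₁ A.X).π.app t =
      A.prodMap (specOver K R).hom ((baseDiagram K R s₁).obj t).hom ((baseCone K R s₁).π.app t).left
        (Over.w _) := by
  apply pullback.hom_ext
  · rw [prodMap_fst]; exact prodCone_π_app_fst K R s₁ A.X t
  · rw [prodMap_snd]; exact prodCone_π_app_snd K R s₁ A.X t

/-- **The transition maps of `prodDiagram` are `1_A × (Spec K[t'] → Spec K[t])`.** [cite: GortzWedhorn2020, Section (4.7) (pp. 107–108)] -/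
theorem prodDiagram_map_eq_prodMap (s₁ : Finset R) {t t' : (Idx R s₁)ᵒᵖ} (φ : t ⟶ t') :
    (prodDiagram K R s₁ A.X).map φ =
      A.prodMap ((baseDiagram K R s₁).obj t).hom ((baseDiagram K R s₁).obj t').hom
        ((baseDiagram K R s₁).map φ).left (Over.w _) := by
  apply pullback.hom_ext
  · rw [prodMap_fst]; exact prodDiagram_map_fst K R s₁ A.X φ
  · rw [prodMap_snd]; exact prodDiagram_map_snd K R s₁ A.X φ


/-! ### §2 The base diagram `Spec K[t]` in `Scheme` and its instances -/

/-- The transition maps `Spec K[t'] → Spec K[t]` of the base diagram are affine (a projective system of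
affine schemes, Görtz–Wedhorn I (10.13) 1.). [cite: GortzWedhorn2020, (10.13) (pp. 261–262)] -/
theorem isAffineHom_baseDiagram_forget_map (s₁ : Finset R) {t t' : (Idx R s₁)ᵒᵖ} (φ : t ⟶ t') :
    IsAffineHom ((baseDiagram K R s₁ ⋙ Over.forget _).map φ) :=
  inferInstanceAs (IsAffineHom ((baseDiagram K R s₁).map φ).left)

/-- The stages `Spec K[t]` are quasi-compact (affine; Görtz–Wedhorn I (10.13) 1.).
[cite: GortzWedhorn2020, (10.13) (pp. 261–262)] -/
theorem compactSpace_baseDiagram_forget_obj (s₁ : Finset R) (t : (Idx R s₁)ᵒᵖ) :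
    CompactSpace ((baseDiagram K R s₁ ⋙ Over.forget _).obj t) :=
  inferInstanceAs (CompactSpace ((baseDiagram K R s₁).obj t).left)

/-- The stages `Spec K[t]` are quasi-separated (affine; Görtz–Wedhorn I (10.13) 1.).
[cite: GortzWedhorn2020, (10.13) (pp. 261–262)] -/
theorem quasiSeparatedSpace_baseDiagram_forget_obj (s₁ : Finset R) (t : (Idx R s₁)ᵒᵖ) :
    QuasiSeparatedSpace ((baseDiagram K R s₁ ⋙ Over.forget _).obj t) :=
  inferInstanceAs (QuasiSeparatedSpace ((baseDiagram K R s₁).obj t).left)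

/-- The stages `Spec K[t] → Spec K` are of finite type (`K[t]` a finitely generated `K`-subalgebra;
Görtz–Wedhorn I (10.13) with Prop. 10.5). [cite: GortzWedhorn2020, (10.13) (pp. 261–262)] -/
theorem locallyOfFiniteType_baseDiagram_obj_hom (s₁ : Finset R) (t : (Idx R s₁)ᵒᵖ) :
    LocallyOfFiniteType ((baseDiagram K R s₁).obj t).hom := by
  change LocallyOfFiniteType (Spec.map (CommRingCat.ofHom (algebraMap K (sub K R t.unop.1))))
  rw [HasRingHomProperty.Spec_iff (P := @LocallyOfFiniteType)]
  exact RingHom.finiteType_algebraMap.mpr inferInstance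

/-! ### §3 The test datum descends to a stage AS A RIGIDIFIED LINE BUNDLE -/

variable {A R} in
/-- **A rigidified line bundle on `A_{Spec R}` comes, as a RIGIDIFIED LINE BUNDLE, from some `A_{Spec K[t]}`**
(`K[t] ⊆ R` finitely generated): the module descends (★ Stacks 0B8W (1)), has rank one there (dominance of
`A × Spec R → A × Spec K[t]`, `hasRank_of_hasRank_pullback_of_denseRange`), and its rigidification descends to a
deeper stage (isomorphisms descend, `exists_stage_iso_of_pullback_iso` on the base diagram).
[cite: StacksProject, Tag 0B8W (Lemma 32.10.3 (1)–(2)) and Tag 01ZR (Lemma 32.10.2)] [cite: MumfordAV1970, §13 (proof of the Thm. p. 125)] -/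
theorem exists_stage_rigidifiedLineBundle (ℒ : A.RigidifiedLineBundle (specOver K R).hom) :
    ∃ (t : (Idx R (∅ : Finset R))ᵒᵖ) (ℒt : A.RigidifiedLineBundle ((baseDiagram K R ∅).obj t).hom),
      Nonempty (ℒ.L ≅ (Scheme.Modules.pullback ((prodCone K R ∅ A.X).π.app t)).obj ℒt.L) := by
  classical
  haveI := A.isProper
  haveI := A.isSmooth
  haveI : UniversallyOpen A.X.hom := A.universallyOpen_hom
  -- Step 1: the module descends (★ Stacks 0B8W (1))
  obtain ⟨t, ℰ, hℰ, ⟨eℰ⟩⟩ := exists_isFiniteLocallyFree_pullback_iso_subalgebra K R ∅ A.X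
    (E := (ℒ.L : (prodCone K R ∅ A.X).pt.Modules)) (HasRank.isFiniteLocallyFree' ℒ.hasRank_one)
  -- Step 2: rank one on the whole stage
  have hℰ1 : HasRank ℰ 1 :=
    hasRank_of_hasRank_pullback_of_denseRange _ (denseRange_prodCone_π_app K R ∅ A.X t) hℰ
      (hasRank_of_iso eℰ.symm ℒ.hasRank_one)
  -- the stage and its unit section
  let Tt : SchemeOver K := (baseDiagram K R ∅).obj t
  let εt : Tt.left ⟶ (prodDiagram K R ∅ A.X).obj t := (A.baseChange Tt.hom).unitSection
  let wt : (specOver K R).left ⟶ Tt.left := ((baseCone K R ∅).π.app t).left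
  have J1 : wt ≫ εt = (A.baseChange (specOver K R).hom).unitSection ≫ (prodCone K R ∅ A.X).π.app t := by
    rw [prodCone_π_app_eq_prodMap, unitSection_comp_prodMap]
  -- the rigidification, pulled back to `Spec R`: `wt^* εt^* ℰ ≅ εR^* πt^* ℰ ≅ εR^* ℒ.L ≅ 𝒪 ≅ wt^* 𝒪`
  have φ : (Scheme.Modules.pullback wt).obj ((Scheme.Modules.pullback εt).obj ℰ) ≅
      (Scheme.Modules.pullback wt).obj (SheafOfModules.unit _) :=
    (Scheme.Modules.pullbackComp wt εt).app ℰ ≪≫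
      (Scheme.Modules.pullbackCongr J1).app ℰ ≪≫
      ((Scheme.Modules.pullbackComp _ _).app ℰ).symm ≪≫
      (Scheme.Modules.pullback _).mapIso eℰ ≪≫ ℒ.rigid.some ≪≫
      (RigidifiedLineBundle.pullbackUnitIso wt).symm
  -- Step 3: this isomorphism descends along the base diagram `Spec K[t'] → Spec K[t]`
  haveI : ∀ {t₁ t₂ : (Idx R (∅ : Finset R))ᵒᵖ} (φ : t₁ ⟶ t₂),
      IsAffineHom ((baseDiagram K R ∅ ⋙ Over.forget _).map φ) :=
    fun φ => isAffineHom_baseDiagram_forget_map R ∅ φ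
  haveI : ∀ t₁ : (Idx R (∅ : Finset R))ᵒᵖ, CompactSpace ((baseDiagram K R ∅ ⋙ Over.forget _).obj t₁) :=
    fun t₁ => compactSpace_baseDiagram_forget_obj R ∅ t₁
  haveI : ∀ t₁ : (Idx R (∅ : Finset R))ᵒᵖ, QuasiSeparatedSpace ((baseDiagram K R ∅ ⋙ Over.forget _).obj t₁) :=
    fun t₁ => quasiSeparatedSpace_baseDiagram_forget_obj R ∅ t₁
  obtain ⟨t', g, ⟨ψ⟩⟩ := FiniteLocallyFreeIsoDescent.exists_stage_iso_of_pullback_iso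
    (baseDiagram K R ∅ ⋙ Over.forget _) ((Over.forget _).mapCone (baseCone K R ∅))
    (isLimitForgetBaseCone K R ∅) (i := t) (HasRank.isFiniteLocallyFree' (hasRank_pullback εt hℰ1))
    (HasRank.isFiniteLocallyFree' (hasRank_unit_one (X := Tt.left))) φ
  -- Step 4: the stage `t'` and the descended rigidified line bundle there
  let Tt' : SchemeOver K := (baseDiagram K R ∅).obj t'
  let g' : Tt' ⟶ Tt := (baseDiagram K R ∅).map g
  let ℰ' : ((prodDiagram K R ∅ A.X).obj t').Modules := (Scheme.Modules.pullback ((prodDiagram K R ∅ A.X).map g)).obj ℰ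
  let εt' : Tt'.left ⟶ (prodDiagram K R ∅ A.X).obj t' := (A.baseChange Tt'.hom).unitSection
  have J2 : εt' ≫ (prodDiagram K R ∅ A.X).map g = g'.left ≫ εt := by
    simp only [εt', εt]
    rw [prodDiagram_map_eq_prodMap, unitSection_comp_prodMap]
  have rigid' : Nonempty ((Scheme.Modules.pullback εt').obj ℰ' ≅ SheafOfModules.unit _) :=
    ⟨(Scheme.Modules.pullbackComp εt' _).app ℰ ≪≫
      (Scheme.Modules.pullbackCongr J2).app ℰ ≪≫
      ((Scheme.Modules.pullbackComp _ _).app ℰ).symm ≪≫ ψ ≪≫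
      RigidifiedLineBundle.pullbackUnitIso g'.left⟩
  refine ⟨t', ⟨ℰ', hasRank_pullback _ hℰ1, rigid'⟩, ⟨?_⟩⟩
  -- `ℒ.L ≅ π_t^* ℰ ≅ (π_{t'} ≫ D g)^* ℰ ≅ π_{t'}^* ℰ'`
  exact eℰ.symm ≪≫ (Scheme.Modules.pullbackCongr ((prodCone K R ∅ A.X).w g).symm).app ℰ ≪≫
    ((Scheme.Modules.pullbackComp _ _).app ℰ).symm


end LimitDescent

/-! ### §4 The fibrewise-`Pic⁰` condition along `1_A × w`, pointwise and in BOTH directions -/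

namespace RigidifiedLineBundle

variable {S : Scheme.{u}} {A : AbelianSchemeOver S}

/-- Homogeneity of the fibre of `ℒ.pullbackBase u` at `t` is homogeneity of the fibre of `ℒ` at `t ≫ u`
(the two fibres are identified by ★ `fibreBaseChangeIso`; B-p02's `FibrewisePicZero.pullbackBase` is `←`).
[cite: MumfordAV1970, §8 ((iv) ⇔ (i))] [cite: MilneAV2008, I §8 pp. 36–37] -/
theorem isHomogeneous_fibre_pullbackBase_iff {T T' : Scheme.{u}} {f : T ⟶ S} (ℒ : A.RigidifiedLineBundle f)
    (u : T' ⟶ T) (Ω : Type u) [Field Ω] [IsAlgClosed Ω] (t : Spec (.of Ω) ⟶ T') :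
    IsHomogeneous (((A.baseChange f).baseChange u).fibre t).toAbelianVariety ((ℒ.pullbackBase u).fibreModule t) ↔
      IsHomogeneous ((A.baseChange f).fibre (t ≫ u)).toAbelianVariety (ℒ.fibreModule (t ≫ u)) := by
  rw [← isHomogeneous_pullback_iff_of_iso ((A.baseChange f).fibreBaseChangeIso u t) (ℒ.fibreModule (t ≫ u))]
  refine (isHomogeneous_iff_of_iso _ ?_).symm
  exact (Scheme.Modules.pullbackComp _ _).app ℒ.L ≪≫
    (Scheme.Modules.pullbackCongr ((A.baseChange f).fibreBaseChangeIso_hom_toSchemeHom_fst u t)).app ℒ.L ≪≫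
    ((Scheme.Modules.pullbackComp _ _).app ℒ.L).symm

/-- Homogeneity of the fibre of `ℒ.alongBaseChange` at `u` is homogeneity of the fibre of `ℒ` at `u`
(★ `fibreAlongBaseChangeIso`; ★ `alongBaseChange_fibrewisePicZero` is `←`). [cite: MumfordAV1970, §8 ((iv) ⇔ (i))] -/
theorem isHomogeneous_fibre_alongBaseChange_iff {S' T : Scheme.{u}} {g : S' ⟶ S} {f' : T ⟶ S'}
    (ℒ : (A.baseChange g).RigidifiedLineBundle f') (Ω : Type u) [Field Ω] [IsAlgClosed Ω] (u : Spec (.of Ω) ⟶ T) :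
    IsHomogeneous ((A.baseChange (f' ≫ g)).fibre u).toAbelianVariety (ℒ.alongBaseChange.fibreModule u) ↔
      IsHomogeneous (((A.baseChange g).baseChange f').fibre u).toAbelianVariety (ℒ.fibreModule u) := by
  rw [← isHomogeneous_pullback_iff_of_iso (A.fibreAlongBaseChangeIso g f' u) (ℒ.fibreModule u)]
  refine (isHomogeneous_iff_of_iso _ ?_).symm
  exact (Scheme.Modules.pullbackComp _ _).app ℒ.L ≪≫
    (Scheme.Modules.pullbackCongr (A.fibreAlongBaseChangeIso_hom_toSchemeHom_fst g f' u)).app ℒ.L ≪≫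
    ((Scheme.Modules.pullbackComp _ _).app ℒ.L).symm

/-- **Homogeneity of the fibre of `ℒ.comapAlong w hw` at `t` is homogeneity of the fibre of `ℒ` at `t ≫ w`.**
[cite: MumfordAV1970, §8 ((iv) ⇔ (i))] [cite: MilneAV2008, I §8 pp. 36–37] -/
theorem isHomogeneous_fibre_comapAlong_iff {T₁ T₂ : Scheme.{u}} {f₁ : T₁ ⟶ S} {f₂ : T₂ ⟶ S}
    (ℒ : A.RigidifiedLineBundle f₂) (w : T₁ ⟶ T₂) (hw : w ≫ f₂ = f₁)
    (Ω : Type u) [Field Ω] [IsAlgClosed Ω] (t : Spec (.of Ω) ⟶ T₁) :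
    IsHomogeneous ((A.baseChange f₁).fibre t).toAbelianVariety ((ℒ.comapAlong w hw).fibreModule t) ↔
      IsHomogeneous ((A.baseChange f₂).fibre (t ≫ w)).toAbelianVariety (ℒ.fibreModule (t ≫ w)) := by
  subst hw
  rw [← ℒ.isHomogeneous_fibre_pullbackBase_iff w Ω t, ← (ℒ.pullbackBase w).isHomogeneous_fibre_alongBaseChange_iff Ω t]
  -- `ℒ.comap w = (ℒ.pullbackBase w).alongBaseChange` and `comapAlong w rfl` have isomorphic modules
  refine (isHomogeneous_iff_of_iso _ ?_).symm
  exact (Scheme.Modules.pullback _).mapIso (ℒ.comapLIso w ≪≫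
    (Scheme.Modules.pullbackCongr (A.restrictLeft_eq_prodMap f₂ w)).app ℒ.L)

/-- **Transport of the fibre condition along an isomorphism of modules on the same base.**
[cite: MumfordAV1970, §8 ((iv) ⇔ (i))] -/
theorem isHomogeneous_fibre_iff_of_iso {T : Scheme.{u}} {f : T ⟶ S} (ℒ ℒ' : A.RigidifiedLineBundle f)
    (e : ℒ.L ≅ ℒ'.L) (Ω : Type u) [Field Ω] [IsAlgClosed Ω] (t : Spec (.of Ω) ⟶ T) :
    IsHomogeneous ((A.baseChange f).fibre t).toAbelianVariety (ℒ.fibreModule t) ↔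
      IsHomogeneous ((A.baseChange f).fibre t).toAbelianVariety (ℒ'.fibreModule t) :=
  isHomogeneous_iff_of_iso _ ((Scheme.Modules.pullback _).mapIso e)

end RigidifiedLineBundle

section LimitDescent

variable {K : Type u} [Field K] (A B : AbelianSchemeOver (Spec (.of K))) (P : (A.prodLeft B).Modules)
  (R : Type u) [CommRing R] [Algebra K R]

variable {A R} in
/-- **The descended rigidified line bundle on `A_{Spec K[t]}` is fibrewise in `Pic⁰`** if the datum on
`A_{Spec R}` is: its `Pic⁰` locus is closed ((0d-2b), hypothesis `hclosed`) and contains the dense image of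
`Spec R → Spec K[t]` ((0d-2): B-p21's `FibrewisePicZero.of_denseRange_of_isClosed`).
[cite: MumfordAV1970, §8 ((iv) ⇔ (i)), §10 (seesaw, p. 89)] [cite: StacksProject, Tag 00FL] -/
theorem fibrewisePicZero_stage
    (hclosed : ∀ (T : Scheme.{u}) [IsAffine T] (f : T ⟶ Spec (.of K)) [LocallyOfFiniteType f]
      (ℒ : A.RigidifiedLineBundle f), IsClosed ℒ.picZeroLocus)
    {t : (Idx R (∅ : Finset R))ᵒᵖ} (ℒ : A.RigidifiedLineBundle (specOver K R).hom) (hℒ : ℒ.FibrewisePicZero)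
    (ℒt : A.RigidifiedLineBundle ((baseDiagram K R ∅).obj t).hom)
    (e : ℒ.L ≅ (Scheme.Modules.pullback ((prodCone K R ∅ A.X).π.app t)).obj ℒt.L) : ℒt.FibrewisePicZero := by
  haveI : LocallyOfFiniteType ((baseDiagram K R ∅).obj t).hom := locallyOfFiniteType_baseDiagram_obj_hom R ∅ t
  refine RigidifiedLineBundle.FibrewisePicZero.of_denseRange_of_isClosed ℒt (hclosed _ _ ℒt)
    ((baseCone K R ∅).π.app t).left (denseRange_baseCone_π_app K R ∅ t) fun Ω _ _ t₁ => ?_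
  -- `ℒ.L ≅ (1 × w)^* ℒt.L = (ℒt.comapAlong w _).L`
  have e' : ℒ.L ≅ (ℒt.comapAlong ((baseCone K R ∅).π.app t).left (Over.w _)).L :=
    e ≪≫ (Scheme.Modules.pullbackCongr (A.prodCone_π_app_eq_prodMap R ∅ t)).app ℒt.L
  exact (ℒt.isHomogeneous_fibre_comapAlong_iff _ (Over.w _) Ω t₁).1
    ((RigidifiedLineBundle.isHomogeneous_fibre_iff_of_iso ℒ _ e' Ω t₁).1 (hℒ Ω t₁))

end LimitDescent

end AbelianSchemeOver

end Literature.AlgebraicGeometry.AbelianSchemes
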